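/-
Copyright (c) 2026 the pub-hodgecm-mathlib formalisation cell (harness21).  Prover seat hodgecm-mathlib-K2E3-p12 (g5), Track B «K2-LIT» ∕ h413
(`stmt-HodgeConjecture-24833`), line `K2_E3_EllipticInputs`, unit U12-d, §L (G⁺-b): THE HOSTED LEAF (LBGL-2b-Tw) `sig_K2E3GL2TwistedRegularNilpotentFourier`
(U12 ED. 14 :797) PAID BY NAME — Harish-Chandra's regularity theorem for the `χ̃`-twisted regular nilpotent orbital integral of `𝔤𝔩₂(F)`.  2026-09-04.
-/
import Summits.HodgeConjecture.HodgeConjecture.Theorems.K2E3GL2TwistedRegularNilpotentFourierOfKAverage   -- (K5d) (this seat): the head from the three K-average inputs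
import Summits.HodgeConjecture.HodgeConjecture.Theorems.K2E3GL2TwistedKAverageCells                      -- ★ (K4-b⁺) (K2E5-p10 g5): bridge + uniform domination
import Summits.HodgeConjecture.HodgeConjecture.Theorems.K2E3GL2TwistedKAverageLocallyConstant            -- ★ p857659 (K4-c) (K2E3-p14 g4): uniform local constancy
import HarnessLib

/-!
# K2_E3 road (h413), §L — (LBGL-2b-Tw) PAID: the `χ̃`-twisted (LBGL-2b) for quadratic quasi-characters

Cell `pub/hodgecm-mathlib` (D-0151), Track B, seat K2E3-p12 (g5), §L line lead (road «U-iso-T»; the (G⁺-b) campaign: line side K2E5-p17 (g3), K-side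
K2E5-p10 (g4∕g5), local constancy K2E3-p14 (g4), assembly this seat).  `--supports stmt-HodgeConjecture-24833 --as helper`; THEOREMS ONLY; never imports
`Cruxes/…/Lines`.  The statement below is the hosted leaf (LBGL-2b-Tw) `sig_K2E3GL2TwistedRegularNilpotentFourier` of
`Lines/K2_E3_EllipticInputsSigs_U12Characters.lean` ED. 14 :797 TOKEN FOR TOKEN (= this seat's SUBSIG v2 5de2c4e2bd026757, K2E3-r01 (g3) PRE-BOX PASS); the
dealer re-ties the leaf `:= @…K2E3GL2TwistedRegularNilpotentFourier.gl2TwistedRegularNilpotentFourier` after a `type_of%` probe.  With it (LBU-2⁺) (already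
tied over this leaf by `tie_LBU2plus_of_subsig` ∕ ★ p857555) is ★, and (L-B_U)′ :885 at `N = 2` is ★ through ★ p857300 — (L-B_U)′ REL over EXACTLY {(LBU-ge3)}.

THE RESULT **`gl2TwistedRegularNilpotentFourier`**: for every non-archimedean local field `F` of characteristic `0`, continuous non-trivial `ψ`, quadratic
non-trivial quasi-character `χ` of `Fˣ`, additive Haar `μ𝔤` on `𝔤𝔩₂(F)`, Haar `κ` on `GL₂(𝒪)` and additive Haar `dx` on `F`, the distribution
`f ↦ ∫_{K×F} χ̃(t·det k)·𝓕_ψ f(k·tE₁₂·k⁻¹) d(κ⊗dx)` — the `χ∘det`-twisted regular nilpotent orbital integral, i.e. the Labesse–Langlands unstable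
combination `μ̂_{𝒪₊} − μ̂_{𝒪₋}` of the two `det⁻¹(ker χ)`-classes of regular nilpotents — is represented by a locally integrable function, locally constant on
`{disc χ ≠ 0}`, with `|disc χ|^{1∕2}·|·|` locally bounded.  Proof = (K5d) `twistedRegularNilpotentFourier_of_KAverage` applied to ★ (K4-b⁺)
`exists_twistedKAverage_eq_cells` ∕ `exists_twistedKAverage_bound` and ★ (K4-c) `twistedKAverage_locallyConstant`.
[HarishChandra1999AdmissibleDistributions, Thm. 4.4 p. 11, Lemma 5.2, §7, Lemma 7.8] [LabesseLanglands1979, §2, §5] [Tate1950, §2.5]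
HONEST LABEL: HC_CM is proved only modulo the 7 printed citations (2 remaining named inputs: hLiu418 = stmt-HodgeConjecture-24832, h413 =
stmt-HodgeConjecture-24833) until rung 0 closes; count-neutral helper until the dealer re-ties the leaf by name.
-/

set_option autoImplicit false
set_option linter.dupNamespace false   -- `Summit.HodgeConjecture.HodgeConjecture.…` (D-0017 nested layout; lakefile exemption for Summits)

noncomputable section

open MeasureTheory Measure Filter Topology
open scoped MatrixGroups NNReal ENNReal
open Literature.NumberTheory.Rogawski1990 Literature.NumberTheory.Automorphic Literature.NumberTheory.Automorphic.LocalFieldHaar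
open Literature.NumberTheory.GaloisRepresentations Literature.NumberTheory.GaloisRepresentations.IsNonarchimedeanLocalField
open Summit.HodgeConjecture.HodgeConjecture.Cruxes.H413.K2E3GL2TwistedRegularNilpotentFourierOfKAverage (twistedRegularNilpotentFourier_of_KAverage)
open Summit.HodgeConjecture.HodgeConjecture.Cruxes.H413.K2E3GL2TwistedKAverageCells (exists_twistedKAverage_eq_cells exists_twistedKAverage_bound)
open Summit.HodgeConjecture.HodgeConjecture.Cruxes.H413.K2E3GL2TwistedKAverageLocallyConstant (twistedKAverage_locallyConstant)

namespace Summit.HodgeConjecture.HodgeConjecture.Cruxes.H413.K2E3GL2TwistedRegularNilpotentFourier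

/-- **(LBGL-2b-Tw) PAID — HARISH-CHANDRA'S REGULARITY THEOREM FOR THE `χ̃`-TWISTED REGULAR NILPOTENT ORBITAL INTEGRAL OF `𝔤𝔩₂(F)`** (U12 ED. 14 :797
`sig_K2E3GL2TwistedRegularNilpotentFourier`, token for token): for `χ` a quadratic non-trivial quasi-character, the Fourier transform of the
`χ̃(t·det k)`-twisted regular nilpotent orbital integral (the unstable combination of the two `det⁻¹(ker χ)`-orbits) is a locally integrable function,
locally constant on the regular set, with `|disc χ|^{1∕2}·|·|` locally bounded.  `:=` ★ (K5d) ∘ (★ (K4-b⁺) bridge + domination, ★ (K4-c) local constancy).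
[cite: HarishChandra1999AdmissibleDistributions, Thm. 4.4 p. 11, Lemma 5.2, Lemma 7.8] [cite: LabesseLanglands1979, §5] [cite: Tate1950, §2.5] -/
theorem gl2TwistedRegularNilpotentFourier :
    ∀ (F : Type) [Field F] [ValuativeRel F] [TopologicalSpace F] [IsNonarchimedeanLocalField F] [CharZero F]
      (ψ : AddChar F Circle), ψ.IsContinuousNontrivial → ∀ (χ : QuasiChar F), (∀ u : Fˣ, χ u * χ u = 1) → (∃ u : Fˣ, χ u ≠ 1) →
      ∀ [MeasurableSpace (Matrix (Fin 2) (Fin 2) F)] [BorelSpace (Matrix (Fin 2) (Fin 2) F)] (μ𝔤 : Measure (Matrix (Fin 2) (Fin 2) F)) [μ𝔤.IsAddHaarMeasure]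
        [MeasurableSpace F] [BorelSpace F] [MeasurableSpace (GL (Fin 2) F)] [BorelSpace (GL (Fin 2) F)]
        (κ : Measure ↥(glInt 2 F)) [IsHaarMeasure κ] (dx : Measure F) [dx.IsAddHaarMeasure],
      ∃ Fr : Matrix (Fin 2) (Fin 2) F → ℂ, LocallyIntegrable Fr μ𝔤 ∧
        (∀ f : Matrix (Fin 2) (Fin 2) F → ℂ, IsLocSmooth f →
          ∫ p : ↥(glInt 2 F) × F, Function.extend ((↑) : Fˣ → F) (fun u => ((χ u : ℂˣ) : ℂ)) 0 (p.2 * (((p.1 : GL (Fin 2) F) : Matrix (Fin 2) (Fin 2) F)).det) *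
            (fun Y : Matrix (Fin 2) (Fin 2) F => ∫ X, ((ψ (Matrix.trace (Y * X)) : Circle) : ℂ) * f X ∂μ𝔤)
              (((p.1 : GL (Fin 2) F) : Matrix (Fin 2) (Fin 2) F) * !![0, p.2; 0, 0] * ((((p.1 : GL (Fin 2) F))⁻¹ : GL (Fin 2) F) : Matrix (Fin 2) (Fin 2) F)) ∂(κ.prod dx) =
            ∫ X, f X * Fr X ∂μ𝔤) ∧
        (∀ X : Matrix (Fin 2) (Fin 2) F, IsUnit X.charpoly.discr → ∀ᶠ Y in 𝓝 X, Fr Y = Fr X) ∧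
        (∀ C : Set (Matrix (Fin 2) (Fin 2) F), IsCompact C → ∃ B : ℝ, ∀ X ∈ C,
            ((NNReal.sqrt (normAbs F X.charpoly.discr) : ℝ≥0) : ℝ) * ‖Fr X‖ ≤ B) :=
  fun _ _ _ _ _ _ _ hψ χ hχ2 hχ1 _ _ μ𝔤 _ _ _ _ _ κ _ dx _ =>
    twistedRegularNilpotentFourier_of_KAverage dx χ hψ hχ2 hχ1 μ𝔤 κ
      (exists_twistedKAverage_eq_cells dx χ hχ2 κ) (exists_twistedKAverage_bound two_ne_zero χ hχ2 hχ1 κ)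
      (twistedKAverage_locallyConstant χ hχ2 κ)

end Summit.HodgeConjecture.HodgeConjecture.Cruxes.H413.K2E3GL2TwistedRegularNilpotentFourier

end
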